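import Summits.HodgeConjecture.HodgeConjecture.Theorems.F0P3LocalConstituentsUnitary    -- ★ (UN) p816648 (this seat): local constituents through a finite component are unitarizable
import Literature.NumberTheory.Rogawski1990.GlobalAPacketMembership                    -- ★ D6: the «constituent at v» currency (`localPiEquiv`, `inclPlace`, `finRep`, `smoothPart`)
import Literature.NumberTheory.Automorphic.IrrClassEigencharacter                     -- ★ p817842 (F0P4-p02): `IrrClass.eigencharacter`, junk + `IsSpherical.isSphericalWith_eigencharacter`
import Literature.NumberTheory.Automorphic.IrreducibleClassesUnitarizable              -- ★ p816767 (typ3): `IrrClass.IsUnitarizable`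
import Literature.NumberTheory.Automorphic.GKModulesAdmissible                         -- ★ `isIrreducible_trivial_self` (one-dimensional ⇒ irreducible)
import Literature.NumberTheory.Automorphic.MatrixCoefficientsTrivialRep                -- ★ `Representation.isUnitarizable_trivial`
import Literature.NumberTheory.Automorphic.LocalUnitaryIntegralLevel                   -- ★ `cmLocalIntegralLevel`, `isCompact_isOpen_cmLocalIntegralLevel`
import HarnessLib

/-!
# Crux `H413` — rung 4, ED. 4 INSTANCE (class-token half): the CHOSEN LOCAL CLASS `clFinChoice P v` of a discrete automorphic `P` at a finite
# place `v`, and its e.v.p. `evpChoice P v` — admissible and unitarizable BY CONSTRUCTION, spherical with its own eigencharacter whenever spherical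

Floor-0 programme P3 «U3-mult», seat F0P3-p02 (g6); crux item stmt-HodgeConjecture-24833 (`HCCMUnconditional.H413`); F0P3-plan (g4) RULING (V24)(d1) «ED. 4 instance
policy for the CLASS tokens» made code (GO 09:28:49Z (a′); statement list 09:30:56Z = planner 09:31:08Z, deviation adopted).  The T5 classification kit
(`Cruxes/H413/Lines/F0_T5InnerFormClassification.lean` v3.1) posits per class `c` and finite place `v` a local coordinate `clFin c v : IrrClass (U(H)(L⁺_v))` and an
e.v.p. `evp c v`, tied to reality by the pins (ii) spherical-with-eigencharacter off `ramCls c`, (iii) Haar, (iv) admissible, (v) unitarizable, (vi) junk `0` off the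
spherical Hecke algebra.  At the NAMED kit `𝔠₀` these tokens must be honest functions of the actual `P`; this file supplies them KIT-FREE (no `Lines` import, s347):
`admUnitConstituents P v` = the set of ADMISSIBLE UNITARIZABLE classes `c` whose pull-back is a constituent of `P.finRep^∞ ∘ inclPlace v` (D6 (b2′) ∕ T5 `LocalIsotypyFin`
phrase VERBATIM), and `clFinChoice P v` = a three-branch CLASSICAL CHOICE — a `K_v`-SPHERICAL member if one exists ▹ else any member ▹ else the trivial class `⟦𝟙⟧` —
so that pins (iv)(v) hold in EVERY branch by construction, pin (vi) by ★ `IrrClass.eigencharacter_of_not`, and pin (ii) (`IsSphericalWith K_v μ_v (evpChoice P v μ_v)`)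
wherever the chosen class is `K_v`-spherical (branches 1 and 3; ★ `IsSpherical.isSphericalWith_eigencharacter`), i.e. REF1 R-12's «`ramCls₀` = exact non-sphericity
set» is served by `isSphericalWith_evpChoice_of_isSpherical` with NO existence hypothesis, and `nonempty_and_not_exists_of_not_isSpherical` places that set inside the
Harish-Chandra–Flath cofinite set.  DEVIATION from the letter of (d1), flagged 09:30:56Z and ADOPTED by the planner 09:31:08Z: UNITARIZABILITY is part of the membership
predicate — sub-quotients of a unitary smooth representation are not unitarizable in general (ℤ on `ℂ[ℤ] ⊂ ℓ²(ℤ)` has the quotient character `n ↦ 2ⁿ`), and the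
in-house unitarizability of constituents (★ (UN) p816648) goes THROUGH an irreducible admissible finite component `σ` of `P` (`HasFinComponent σ`), which a bare
discrete `P` does not carry in-house (Harish-Chandra–Flath, the `hAF` letter of (V24)(d2)); §4 proves the clause automatic under `HasFinComponent σ`.  In print
(`P_v` irreducible admissible unitary, [Rogawski1990 §14.5 p. 237; Flath1979 Thm. 3]) `admUnitConstituents P v = {[P_v]}` and branches 1∕2 return the genuine local
component; the classical `if` is not smuggling (planner (d1)).  Binders exactly T5-A's: `v : HeightOneSpectrum (𝓞 L⁺)` (= `Places L` unfolded), measures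
`μv : @Measure (G′_v) (borel _)` with `IsHaarMeasure` under `letI := borel _` (the `hatBounded_cls_of_pins` dance), so that at `𝔠₀`
`clFin₀ c v := clFinChoice (rep c) v`, `evp₀ c v := evpChoice (rep c) v (μv v)` need no cast and each pin discharge is one `exact`.
DEF lane (`--kind definition`): data defs `trivialIrrep`, `trivialClass`, `admUnitConstituents` (a `Set`), `clFinChoice`, `evpChoice` with bodies; no Prop-valued def, no
named fact, no instance, no notation, no `sorry`; every theorem axioms ⊆ {propext, Classical.choice, Quot.sound}.

* §1 generic: `isSmooth_trivial_self`, `fixedPoints_trivial_self_eq_top`, `isAdmissible_trivial_self`, `isSpherical_trivial_self` (the trivial representation on `ℂ`);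
  CM frame: `trivialIrrep v`, `trivialClass v` (= `⟦𝟙⟧`), `trivialClass_isAdmissible ∕ _isUnitarizable ∕ _isSpherical`.
* §2 `admUnitConstituents P v`, `mem_admUnitConstituents_iff` (rfl), `clFinChoice P v` + `clFinChoice_spec_of_exists_spherical`, `clFinChoice_mem_of_nonempty`,
  `clFinChoice_eq_trivialClass_of_not_nonempty`, `clFinChoice_isAdmissible` (pin (iv)), `clFinChoice_isUnitarizable` (pin (v)), `clFinChoice_isSpherical_of_exists`,
  `clFinChoice_isSpherical_of_not_nonempty`, `nonempty_and_not_exists_of_not_isSpherical` (R-12), `clFinChoice_isConstituentOf_of_nonempty` (D6 phrase verbatim).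
* §3 `evpChoice P v μv` + `evpChoice_of_not` (pin (vi)), `isSphericalWith_evpChoice_of_isSpherical` (pin (ii) from sphericity alone), `isSphericalWith_evpChoice_of_exists`.
* §4 `isUnitarizable_comap` (classes: unitarizability along `comap e`), `mem_admUnitConstituents_of_hasFinComponent` (the deviation is void under `HasFinComponent σ`,
  ★ (UN)), `clFinChoice_isConstituentOf_of_hasFinComponent`.
HONEST LABEL: HC_CM is proved only modulo the printed citations until rung 0 closes; this file discharges none of them and asserts nothing (choices + their specs).
References: Rogawski (1990) §13.7 p. 206, §14.5 p. 237 [Rogawski1990]; Flath (1979) Thm. 3 [FlathCorvallis1979]; Cartier (1979) §IV.1 [CartierCorvallis1979];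
Bushnell–Henniart (2006) §11.1 [BushnellHenniart2006].
-/

set_option autoImplicit false
-- the mandated namespace repeats `HodgeConjecture.HodgeConjecture`, as in every `Theorems/*.lean` of this sub-problem
set_option linter.dupNamespace false

noncomputable section

open MeasureTheory NumberField IsDedekindDomain

namespace Summit.HodgeConjecture.HodgeConjecture.Cruxes.H413.F0P3ClassTokenChoice

open Literature.NumberTheory.Automorphic Literature.NumberTheory.Automorphic.UnitaryGroup

/-! ## §1 The trivial class `⟦𝟙⟧` -/

section Trivial

variable (G : Type) [Group G]

/-- The trivial representation of a topological group on `ℂ` is smooth: every stabiliser is the whole group. [cite: CartierCorvallis1979, §IV.1] -/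
theorem isSmooth_trivial_self [TopologicalSpace G] : (Representation.trivial ℂ G ℂ).IsSmooth := fun x => by
  have h : ((Representation.trivial ℂ G ℂ).stabilizerSubgroup x : Set G) = Set.univ := Set.eq_univ_of_forall fun g => by simp
  change IsOpen ((Representation.trivial ℂ G ℂ).stabilizerSubgroup x : Set G)
  rw [h]
  exact isOpen_univ

/-- Every vector of the trivial representation on `ℂ` is fixed by every subgroup: `ℂ^K = ℂ`. [cite: CartierCorvallis1979, §IV.1] -/
theorem fixedPoints_trivial_self_eq_top (K : Subgroup G) : (Representation.trivial ℂ G ℂ).fixedPoints K = ⊤ :=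
  eq_top_iff.2 fun v _ => (Representation.mem_fixedPoints _ K v).2 fun g _ => by simp

/-- The trivial representation on `ℂ` is admissible (`ℂ^K ⊆ ℂ` is finite-dimensional). [cite: CartierCorvallis1979, §IV.1] -/
theorem isAdmissible_trivial_self [TopologicalSpace G] : (Representation.trivial ℂ G ℂ).IsAdmissible :=
  ⟨isSmooth_trivial_self G, fun _ _ => inferInstance⟩

/-- The trivial representation on `ℂ` is `K`-spherical for EVERY subgroup `K` (`dim ℂ^K = 1`). [cite: CartierCorvallis1979, §IV.1] -/
theorem isSpherical_trivial_self (K : Subgroup G) : (Representation.trivial ℂ G ℂ).IsSpherical K := by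
  rw [Representation.isSpherical_iff, fixedPoints_trivial_self_eq_top, finrank_top, Module.finrank_self]

end Trivial

variable {L : Type} [Field L] [NumberField L] [IsCMField L] {H : Matrix (Fin 3) (Fin 3) L}

/-- **The trivial smooth irreducible representation `𝟙` of `U(H)(L⁺_v)` on `ℂ`** (one-dimensional ⇒ irreducible, ★ `isIrreducible_trivial_self`).
[cite: CartierCorvallis1979, §IV.1] -/
def trivialIrrep (v : HeightOneSpectrum (𝓞 ↥(maximalRealSubfield L))) : SmoothIrrep ((cmDatum L 3 H).Local v) where
  V := ℂ
  ρ := Representation.trivial ℂ ((cmDatum L 3 H).Local v) ℂ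
  isIrreducible := isIrreducible_trivial_self ℂ ((cmDatum L 3 H).Local v)
  isSmooth := isSmooth_trivial_self ((cmDatum L 3 H).Local v)

/-- **`⟦𝟙⟧`, the class of the trivial representation of `U(H)(L⁺_v)`** — the fallback value of `clFinChoice`. [cite: CartierCorvallis1979, §IV.1] -/
def trivialClass (v : HeightOneSpectrum (𝓞 ↥(maximalRealSubfield L))) : IrrClass ((cmDatum L 3 H).Local v) :=
  IrrClass.mk (trivialIrrep (H := H) v)

/-- `⟦𝟙⟧` is admissible. [cite: CartierCorvallis1979, §IV.1] -/
theorem trivialClass_isAdmissible (v : HeightOneSpectrum (𝓞 ↥(maximalRealSubfield L))) : (trivialClass (H := H) v).IsAdmissible := by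
  rw [trivialClass, IrrClass.isAdmissible_mk]
  exact isAdmissible_trivial_self ((cmDatum L 3 H).Local v)

/-- `⟦𝟙⟧` is unitarizable (★ `Representation.isUnitarizable_trivial` on the inner product space `ℂ`). [cite: Rogawski1990, §14.5 p. 237] -/
theorem trivialClass_isUnitarizable (v : HeightOneSpectrum (𝓞 ↥(maximalRealSubfield L))) : (trivialClass (H := H) v).IsUnitarizable := by
  rw [trivialClass, IrrClass.isUnitarizable_mk]
  change (Representation.trivial ℂ ((cmDatum L 3 H).Local v) ℂ).IsUnitarizable
  exact Representation.isUnitarizable_trivial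

/-- `⟦𝟙⟧` is `K`-spherical for every subgroup `K` of `U(H)(L⁺_v)`. [cite: CartierCorvallis1979, §IV.1] -/
theorem trivialClass_isSpherical (v : HeightOneSpectrum (𝓞 ↥(maximalRealSubfield L))) (K : Subgroup ((cmDatum L 3 H).Local v)) :
    (trivialClass (H := H) v).IsSpherical K := by
  rw [trivialClass, IrrClass.isSpherical_mk]
  exact isSpherical_trivial_self ((cmDatum L 3 H).Local v) K

/-! ## §2 The admissible unitarizable constituents of `P` at `v` and the chosen local class `clFinChoice P v` -/

section Choice

variable {μ : Measure (adelicGroupData (↥(maximalRealSubfield L)) L (IsCMField.complexConj L) 3 H).automorphicQuotient}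
  [(adelicGroupData (↥(maximalRealSubfield L)) L (IsCMField.complexConj L) 3 H).IsAutomorphicMeasure μ]

/-- **`admUnitConstituents P v` — the ADMISSIBLE UNITARIZABLE CONSTITUENTS of `P` at `v`**: the set of classes `c ∈ Irr(U(H)(L⁺_v))` whose pull-back along ★
`localPiEquiv v` is a constituent of `P.finRep^∞ ∘ inclPlace v` (the D6 (b2′) ∕ T5 `LocalIsotypyFin` currency VERBATIM) and which are admissible and unitarizable.
In print this set is `{[P_v]}` (`P_v` irreducible admissible unitary) [Rogawski1990 §14.5 p. 237; Flath1979 Thm. 3]; §4 derives the unitarizability clause from an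
admissible finite component. [cite: Rogawski1990, §14.5 p. 237] [cite: FlathCorvallis1979, Thm. 3] -/
def admUnitConstituents (P : DiscreteAutomorphicRep (adelicGroupData (↥(maximalRealSubfield L)) L (IsCMField.complexConj L) 3 H) μ)
    (v : HeightOneSpectrum (𝓞 ↥(maximalRealSubfield L))) : Set (IrrClass ((cmDatum L 3 H).Local v)) :=
  {c | (IrrClass.comap (localPiEquiv L (IsCMField.complexConj L) 3 H v) c).IsConstituentOf
      (P.finRep.smoothPart.toRepresentation.comp (inclPlace (↥(maximalRealSubfield L)) L (IsCMField.complexConj L) 3 H v)) ∧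
    c.IsAdmissible ∧ c.IsUnitarizable}

/-- **`clFinChoice P v` — THE CHOSEN LOCAL CLASS of `P` at `v`** (RULING (V24)(d1) as code): (1) an admissible unitarizable `K_v`-SPHERICAL constituent of `P` at `v` if some
exists (`K_v` = ★ `cmLocalIntegralLevel`), else (2) an admissible unitarizable constituent if some exists, else (3) `⟦𝟙⟧`.  In print branches (1)∕(2) return the local
component `P_v`, spherical off a finite set of places. [cite: Rogawski1990, §14.5 p. 237; §13.7 p. 206] [cite: FlathCorvallis1979, Thm. 3] -/
def clFinChoice (P : DiscreteAutomorphicRep (adelicGroupData (↥(maximalRealSubfield L)) L (IsCMField.complexConj L) 3 H) μ)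
    (v : HeightOneSpectrum (𝓞 ↥(maximalRealSubfield L))) : IrrClass ((cmDatum L 3 H).Local v) :=
  open scoped Classical in
  if h₁ : ∃ c ∈ admUnitConstituents P v, c.IsSpherical (cmLocalIntegralLevel L 3 H v) then h₁.choose
  else if h₂ : (admUnitConstituents P v).Nonempty then h₂.some
  else trivialClass v

variable (P : DiscreteAutomorphicRep (adelicGroupData (↥(maximalRealSubfield L)) L (IsCMField.complexConj L) 3 H) μ)
  (v : HeightOneSpectrum (𝓞 ↥(maximalRealSubfield L)))

/-- Unfolding `admUnitConstituents` (definitional). [cite: Rogawski1990, §14.5 p. 237] -/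
theorem mem_admUnitConstituents_iff (c : IrrClass ((cmDatum L 3 H).Local v)) :
    c ∈ admUnitConstituents P v ↔
      (IrrClass.comap (localPiEquiv L (IsCMField.complexConj L) 3 H v) c).IsConstituentOf
          (P.finRep.smoothPart.toRepresentation.comp (inclPlace (↥(maximalRealSubfield L)) L (IsCMField.complexConj L) 3 H v)) ∧
        c.IsAdmissible ∧ c.IsUnitarizable :=
  Iff.rfl

/-- **Branch 1**: if an admissible unitarizable `K_v`-spherical constituent exists, `clFinChoice P v` is one. [cite: Rogawski1990, §13.7 p. 206] -/
theorem clFinChoice_spec_of_exists_spherical (h₁ : ∃ c ∈ admUnitConstituents P v, c.IsSpherical (cmLocalIntegralLevel L 3 H v)) :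
    clFinChoice P v ∈ admUnitConstituents P v ∧ (clFinChoice P v).IsSpherical (cmLocalIntegralLevel L 3 H v) := by
  rw [clFinChoice, dif_pos h₁]
  exact h₁.choose_spec

/-- **Branches 1∕2**: if an admissible unitarizable constituent exists, `clFinChoice P v` is an admissible unitarizable constituent.
[cite: Rogawski1990, §14.5 p. 237] [cite: FlathCorvallis1979, Thm. 3] -/
theorem clFinChoice_mem_of_nonempty (h₂ : (admUnitConstituents P v).Nonempty) : clFinChoice P v ∈ admUnitConstituents P v := by
  by_cases h₁ : ∃ c ∈ admUnitConstituents P v, c.IsSpherical (cmLocalIntegralLevel L 3 H v)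
  · exact (clFinChoice_spec_of_exists_spherical P v h₁).1
  · rw [clFinChoice, dif_neg h₁, dif_pos h₂]
    exact h₂.some_mem

/-- **Branch 3**: if NO admissible unitarizable constituent exists, `clFinChoice P v = ⟦𝟙⟧`. [cite: Rogawski1990, §14.5 p. 237] -/
theorem clFinChoice_eq_trivialClass_of_not_nonempty (h : ¬ (admUnitConstituents P v).Nonempty) : clFinChoice P v = trivialClass v := by
  have h₁ : ¬ ∃ c ∈ admUnitConstituents P v, c.IsSpherical (cmLocalIntegralLevel L 3 H v) := fun ⟨c, hc, _⟩ => h ⟨c, hc⟩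
  rw [clFinChoice, dif_neg h₁, dif_neg h]

/-- **Pin (iv) by construction**: `clFinChoice P v` is ADMISSIBLE in every branch. [cite: Rogawski1990, §14.5 p. 237] -/
theorem clFinChoice_isAdmissible : (clFinChoice P v).IsAdmissible := by
  by_cases h₂ : (admUnitConstituents P v).Nonempty
  · exact (clFinChoice_mem_of_nonempty P v h₂).2.1
  · rw [clFinChoice_eq_trivialClass_of_not_nonempty P v h₂]
    exact trivialClass_isAdmissible v

/-- **Pin (v) by construction**: `clFinChoice P v` is UNITARIZABLE in every branch. [cite: Rogawski1990, §14.5 p. 237] -/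
theorem clFinChoice_isUnitarizable : (clFinChoice P v).IsUnitarizable := by
  by_cases h₂ : (admUnitConstituents P v).Nonempty
  · exact (clFinChoice_mem_of_nonempty P v h₂).2.2
  · rw [clFinChoice_eq_trivialClass_of_not_nonempty P v h₂]
    exact trivialClass_isUnitarizable v

/-- In branch 1, `clFinChoice P v` is `K_v`-spherical. [cite: CartierCorvallis1979, §IV.1] -/
theorem clFinChoice_isSpherical_of_exists (h₁ : ∃ c ∈ admUnitConstituents P v, c.IsSpherical (cmLocalIntegralLevel L 3 H v)) :
    (clFinChoice P v).IsSpherical (cmLocalIntegralLevel L 3 H v) :=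
  (clFinChoice_spec_of_exists_spherical P v h₁).2

/-- In branch 3, `clFinChoice P v = ⟦𝟙⟧` is `K_v`-spherical as well. [cite: CartierCorvallis1979, §IV.1] -/
theorem clFinChoice_isSpherical_of_not_nonempty (h : ¬ (admUnitConstituents P v).Nonempty) :
    (clFinChoice P v).IsSpherical (cmLocalIntegralLevel L 3 H v) := by
  rw [clFinChoice_eq_trivialClass_of_not_nonempty P v h]
  exact trivialClass_isSpherical v _

/-- **Exact non-sphericity is branch 2** (for REF1 R-12's `ramCls₀ :=` exact non-sphericity set): if `clFinChoice P v` is NOT `K_v`-spherical, then `P` HAS an admissible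
unitarizable constituent at `v` but NO `K_v`-spherical one — so the non-sphericity places of the chosen classes lie inside any set off which spherical admissible unitarizable
constituents exist (finite by Harish-Chandra–Flath). [cite: FlathCorvallis1979, Thm. 3] [cite: Rogawski1990, §14.5 p. 237] -/
theorem nonempty_and_not_exists_of_not_isSpherical (h : ¬ (clFinChoice P v).IsSpherical (cmLocalIntegralLevel L 3 H v)) :
    (admUnitConstituents P v).Nonempty ∧ ¬ ∃ c ∈ admUnitConstituents P v, c.IsSpherical (cmLocalIntegralLevel L 3 H v) :=
  ⟨not_not.1 fun h' => h (clFinChoice_isSpherical_of_not_nonempty P v h'), fun h' => h (clFinChoice_isSpherical_of_exists P v h')⟩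

/-- In branches 1∕2, `clFinChoice P v` IS a constituent of `P` at `v`, in the D6 currency verbatim. [cite: FlathCorvallis1979, Thm. 3] -/
theorem clFinChoice_isConstituentOf_of_nonempty (h₂ : (admUnitConstituents P v).Nonempty) :
    (IrrClass.comap (localPiEquiv L (IsCMField.complexConj L) 3 H v) (clFinChoice P v)).IsConstituentOf
      (P.finRep.smoothPart.toRepresentation.comp (inclPlace (↥(maximalRealSubfield L)) L (IsCMField.complexConj L) 3 H v)) :=
  (clFinChoice_mem_of_nonempty P v h₂).1

/-! ## §3 The chosen e.v.p. `evpChoice P v` -/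

/-- **`evpChoice P v μ_v` — the e.v.p. of the chosen class**: the NORMALISED EIGENCHARACTER of `clFinChoice P v` at level `K_v` for the measure `μ_v` (★ `IrrClass.eigencharacter`:
`f ↦ μ_v(K_v)⁻¹ tr c(f)` on `C_c(K_v\G_v/K_v)`, `0` elsewhere); typed against the T5 kit's `μv v : @Measure (G′_v) (borel _)`.
[cite: Rogawski1990, §13.7 p. 206] [cite: CartierCorvallis1979, §IV.1] -/
def evpChoice (μv : @Measure ((cmDatum L 3 H).Local v) (borel _)) : ((cmDatum L 3 H).Local v → ℂ) → ℂ :=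
  letI : MeasurableSpace ((cmDatum L 3 H).Local v) := borel _
  (clFinChoice P v).eigencharacter (cmLocalIntegralLevel L 3 H v) μv

/-- **Pin (vi) — JUNK CONVENTION**: off the spherical Hecke algebra `C_c(K_v\G_v/K_v)` the chosen e.v.p. is `0` (★ `IrrClass.eigencharacter_of_not`).
[cite: CartierCorvallis1979, §IV.1] -/
theorem evpChoice_of_not (μv : @Measure ((cmDatum L 3 H).Local v) (borel _)) {f : (cmDatum L 3 H).Local v → ℂ}
    (hf : ¬ (HasCompactSupport f ∧ IsLevel (cmLocalIntegralLevel L 3 H v) f)) : evpChoice P v μv f = 0 := by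
  letI : MeasurableSpace ((cmDatum L 3 H).Local v) := borel _
  exact (clFinChoice P v).eigencharacter_of_not (cmLocalIntegralLevel L 3 H v) μv hf

/-- **Pin (ii) shape, from sphericity alone**: for a Haar measure `μ_v`, if the chosen class is `K_v`-spherical (branches 1 and 3) it is `K_v`-SPHERICAL WITH the chosen e.v.p.
(★ `IsSpherical.isSphericalWith_eigencharacter`, admissibility by construction; `μ_v(K_v) ≠ 0` because `K_v` is compact open, ★ `isCompact_isOpen_cmLocalIntegralLevel`).
[cite: CartierCorvallis1979, §IV.1 Cor. 4.1] [cite: Rogawski1990, §13.7 p. 206] -/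
theorem isSphericalWith_evpChoice_of_isSpherical (μv : @Measure ((cmDatum L 3 H).Local v) (borel _))
    (hμ : letI : MeasurableSpace ((cmDatum L 3 H).Local v) := borel _; μv.IsHaarMeasure)
    (hs : (clFinChoice P v).IsSpherical (cmLocalIntegralLevel L 3 H v)) :
    letI : MeasurableSpace ((cmDatum L 3 H).Local v) := borel _
    (clFinChoice P v).IsSphericalWith (cmLocalIntegralLevel L 3 H v) μv (evpChoice P v μv) := by
  letI : MeasurableSpace ((cmDatum L 3 H).Local v) := borel _
  haveI : BorelSpace ((cmDatum L 3 H).Local v) := ⟨rfl⟩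
  haveI : μv.IsHaarMeasure := hμ
  obtain ⟨hKc, hKo⟩ := isCompact_isOpen_cmLocalIntegralLevel L 3 H v
  have hμK : μv.real (cmLocalIntegralLevel L 3 H v : Set ((cmDatum L 3 H).Local v)) ≠ 0 := by
    rw [measureReal_def, ENNReal.toReal_ne_zero]
    exact ⟨(hKo.measure_pos μv ⟨1, (cmLocalIntegralLevel L 3 H v).one_mem⟩).ne', hKc.measure_lt_top.ne⟩
  exact IrrClass.IsSpherical.isSphericalWith_eigencharacter μv (clFinChoice_isAdmissible P v) hKo hKc hμK hs

/-- **Pin (ii) shape in branch 1**: for a Haar measure `μ_v`, if an admissible unitarizable `K_v`-spherical constituent exists, the chosen class is `K_v`-spherical with the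
chosen e.v.p. [cite: CartierCorvallis1979, §IV.1 Cor. 4.1] [cite: Rogawski1990, §13.7 p. 206] -/
theorem isSphericalWith_evpChoice_of_exists (μv : @Measure ((cmDatum L 3 H).Local v) (borel _))
    (hμ : letI : MeasurableSpace ((cmDatum L 3 H).Local v) := borel _; μv.IsHaarMeasure)
    (h₁ : ∃ c ∈ admUnitConstituents P v, c.IsSpherical (cmLocalIntegralLevel L 3 H v)) :
    letI : MeasurableSpace ((cmDatum L 3 H).Local v) := borel _
    (clFinChoice P v).IsSphericalWith (cmLocalIntegralLevel L 3 H v) μv (evpChoice P v μv) :=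
  isSphericalWith_evpChoice_of_isSpherical P v μv hμ (clFinChoice_isSpherical_of_exists P v h₁)

end Choice

/-! ## §4 Under an admissible finite component the unitarizability clause is automatic -/

/-- Unitarizability of a class is preserved under pull-back along an isomorphism of topological groups `e : G′ ≃ₜ* G` (the same Hermitian form is invariant for
`r ∘ e`; ★ `isUnitarizable_comp`). [cite: BushnellHenniart2006, §11.1] -/
theorem isUnitarizable_comap {G G' : Type} [Group G] [TopologicalSpace G] [Group G'] [TopologicalSpace G'] (e : G' ≃ₜ* G) {c : IrrClass G}
    (hc : c.IsUnitarizable) : (IrrClass.comap e c).IsUnitarizable := by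
  induction c using IrrClass.ind with
  | h r =>
    rw [IrrClass.comap_mk, IrrClass.isUnitarizable_mk, SmoothIrrep.comap_ρ]
    exact F0P3LocalConstituentsUnitary.isUnitarizable_comp ((IrrClass.isUnitarizable_mk r).1 hc) (e : G' →* G)

section FinComponent

variable {μ : Measure (adelicGroupData (↥(maximalRealSubfield L)) L (IsCMField.complexConj L) 3 H).automorphicQuotient}
  [(adelicGroupData (↥(maximalRealSubfield L)) L (IsCMField.complexConj L) 3 H).IsAutomorphicMeasure μ]

/-- **The unitarizability clause is void under `HasFinComponent σ`**: if `P` has an irreducible ADMISSIBLE finite component `σ`, an admissible constituent `c` of `P` at `v`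
is automatically unitarizable (★ (UN) `exists_unitarizable_rep_of_comap_isConstituentOf_cm`, pushed forward along `localPiEquiv⁻¹`), i.e. `c ∈ admUnitConstituents P v`.
[cite: Rogawski1990, §14.5 p. 237] [cite: FlathCorvallis1979, Thm. 3] -/
theorem mem_admUnitConstituents_of_hasFinComponent
    (P : DiscreteAutomorphicRep (adelicGroupData (↥(maximalRealSubfield L)) L (IsCMField.complexConj L) 3 H) μ)
    {W : Type} [AddCommGroup W] [Module ℂ W] (σ : Representation ℂ (finAdelic (↥(maximalRealSubfield L)) L (IsCMField.complexConj L) 3 H) W)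
    (hirr : σ.IsIrreducible) (hadm : σ.IsAdmissible) (hP : P.HasFinComponent σ) (v : HeightOneSpectrum (𝓞 ↥(maximalRealSubfield L)))
    {c : IrrClass ((cmDatum L 3 H).Local v)}
    (hc : (IrrClass.comap (localPiEquiv L (IsCMField.complexConj L) 3 H v) c).IsConstituentOf
      (P.finRep.smoothPart.toRepresentation.comp (inclPlace (↥(maximalRealSubfield L)) L (IsCMField.complexConj L) 3 H v)))
    (ha : c.IsAdmissible) : c ∈ admUnitConstituents P v := by
  obtain ⟨r, hr, hru⟩ := F0P3LocalConstituentsUnitary.exists_unitarizable_rep_of_comap_isConstituentOf_cm P σ hirr hadm hP v c hc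
  refine ⟨hc, ha, ?_⟩
  -- `r` represents the pulled-back class `comap e c`; push forward along `e⁻¹` (`comap e⁻¹ (comap e c) = c`)
  rw [← IrrClass.comap_symm_comap (localPiEquiv L (IsCMField.complexConj L) 3 H v) c]
  exact isUnitarizable_comap _ (IrrClass.IsUnitarizable.of_mk_eq hr hru)

/-- Hence, under an admissible finite component, «an ADMISSIBLE constituent exists at `v`» already puts `clFinChoice P v` in branches 1∕2 (a genuine constituent).
[cite: Rogawski1990, §14.5 p. 237] [cite: FlathCorvallis1979, Thm. 3] -/
theorem clFinChoice_isConstituentOf_of_hasFinComponent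
    (P : DiscreteAutomorphicRep (adelicGroupData (↥(maximalRealSubfield L)) L (IsCMField.complexConj L) 3 H) μ)
    {W : Type} [AddCommGroup W] [Module ℂ W] (σ : Representation ℂ (finAdelic (↥(maximalRealSubfield L)) L (IsCMField.complexConj L) 3 H) W)
    (hirr : σ.IsIrreducible) (hadm : σ.IsAdmissible) (hP : P.HasFinComponent σ) (v : HeightOneSpectrum (𝓞 ↥(maximalRealSubfield L)))
    (h : ∃ c : IrrClass ((cmDatum L 3 H).Local v),
      (IrrClass.comap (localPiEquiv L (IsCMField.complexConj L) 3 H v) c).IsConstituentOf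
          (P.finRep.smoothPart.toRepresentation.comp (inclPlace (↥(maximalRealSubfield L)) L (IsCMField.complexConj L) 3 H v)) ∧
        c.IsAdmissible) :
    (IrrClass.comap (localPiEquiv L (IsCMField.complexConj L) 3 H v) (clFinChoice P v)).IsConstituentOf
      (P.finRep.smoothPart.toRepresentation.comp (inclPlace (↥(maximalRealSubfield L)) L (IsCMField.complexConj L) 3 H v)) := by
  obtain ⟨c, hc, ha⟩ := h
  exact clFinChoice_isConstituentOf_of_nonempty P v ⟨c, mem_admUnitConstituents_of_hasFinComponent P σ hirr hadm hP v hc ha⟩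

end FinComponent

end Summit.HodgeConjecture.HodgeConjecture.Cruxes.H413.F0P3ClassTokenChoice

end
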